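import Summits.Ventures.PercRepro.RankLevelSetLevelSixHeavyCellSq27DI2U
import Summits.Ventures.PercRepro.RankLevelSetCoreSixColoopFreeUnion
import Summits.Ventures.PercRepro.RankLevelSetLevelSixCapGlue25
import Summits.Ventures.PercRepro.TriangleCapEightI
import Summits.Ventures.PercRepro.S1TrianglePlusSharp
import Summits.Ventures.PercRepro.S1SeriesLever14
import Summits.Ventures.PercRepro.RankLevelSetLevelSixArithHeavySq23DF9A

/-!
# PercRepro — THE 24 ROW, THE COLOOP CASE AT CORANK `9`, LEVEL ONE: THE SCALED COLOOP-FREE CELL `(p ≥ 23, 9)` (p8 g10, S3)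

`proofs/SUBCLAIM-S3-p8.md` §3x. `(Φ(p+1, 6)/2)·#U ≤ #Y` on a coloop-free core of rank `p ≥ 23`, corank `9`, with the full coloop-free kit (`|UG| ≤ 16`, `|UH| ≤ 14`, `gb14 9 32 = 89`, caps at `n₀ = 32`; `D = C(p + 7, 6)`, parts ArithHeavySq23DF9A). Axioms: standard.
-/

open scoped Matroid

namespace PercRepro

namespace ThmN

open Set

variable {α : Type}

/-- **THE 24 ROW, THE COLOOP CASE AT CORANK `9`, LEVEL ONE: THE SCALED COLOOP-FREE CELL `(p ≥ 23, 9)`**: ratio `0.801`. -/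
theorem c025_core_six_scaled_basis_sq23s9 (M : Matroid α) [M.Finite] (p : ℕ) (hp : 23 ≤ p) (hcf : ∀ e ∈ M.E, ¬ M.IsColoop e)
    (hR : M.eRank = (p : ℕ∞)) (hn : M.E.ncard = p + 9)
    (hfree : ∀ e ∈ M.E, ∃ A ⊆ M.E \ {e}, e ∉ M.closure A ∧ e ∉ M.closure ((M.E \ {e}) \ A)) :
    phiK (p + 1) 6 / 2 * (Matroid.topCount M p 6 : ℚ) ≤ (Matroid.midCount M p 6 : ℚ) := by
  classical
  have hd : M.E.encard = M.eRank + (9 : ℕ) := by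
    rw [hR, ← M.ground_finite.cast_ncard_eq, hn]
    push_cast
    ring
  have hL : ∀ e ∈ M.E, ¬ M.IsLoop e := not_isLoop_of_free M hfree
  have hs : ∀ e ∈ M.E, ∀ f ∈ M.E, e ≠ f → M.eRk {e, f} = 2 := by
    intro e he f hf hef
    have h2 : (2 : ℕ∞) ≤ M.eRk {e, f} :=
      two_le_eRk_of_two_le_ncard_of_free M hfree (pair_subset he hf) (by rw [ncard_pair hef])
    have h3 : M.eRk {e, f} ≤ 2 := by
      have := M.eRk_le_encard {e, f}
      rwa [encard_pair hef] at this
    exact le_antisymm h3 h2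
  have hC1 : ∀ L ⊆ M.E, M.eRk L = 2 → L.ncard ≤ 3 :=
    fun L hL hr => ncard_le_three_of_eRk_two M hs hfree hL hr
  have hC2 : ∀ P ⊆ M.E, M.eRk P ≤ 3 → P.ncard ≤ 6 :=
    fun P hP hr => ncard_le_six_of_eRk_le_three_of_free M hfree hP hr
  have hc : ∀ X ⊆ M.E, M.eRk X ≤ ((6 - 2 : ℕ) : ℕ∞) → (X.ncard : ℕ∞) ≤ M.eRk X + cnull 4 :=
    fun X hX hr => nullity_cap_core M hfree 4 (le_refl 4) X hX (by simpa using hr)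
  have hc6 : cnull 4 + 1 ≤ 7 := by simp [cnull]
  have hcj : ∀ X ⊆ M.E, M.eRk X ≤ ((6 - 2 - 1 : ℕ) : ℕ∞) → (X.ncard : ℕ∞) ≤ M.eRk X + cnull (5 - 2) :=
    fun X hX hr => nullity_cap_core M hfree (5 - 2) (by omega) X hX
      (by rwa [show (6 - 2 - 1 : ℕ) = 5 - 2 by omega] at hr)
  have hcj' : ∀ X ⊆ M.E, M.eRk X ≤ ((6 - 1 - 1 - 1 : ℕ) : ℕ∞) → (X.ncard : ℕ∞) ≤ M.eRk X + cnull (4 - 1) :=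
    fun X hX hr => nullity_cap_core M hfree (4 - 1) (by omega) X hX
      (by rwa [show (6 - 1 - 1 - 1 : ℕ) = 4 - 1 by omega] at hr)
  have hUG : (Matroid.UG M 6 7).ncard ≤ 16 := by
    have := Matroid.ncard_UG_le_cf (M := M) (q := 6) (ν₁ := 7) (j := 2) (by norm_num) hcf hR hn (by omega) hc hc6 hcj (by norm_num [cnull])
    simpa using this
  have hUH : (Matroid.UH M 6 7).ncard ≤ 14 := by
    have := Matroid.ncard_UH_le_cf (M := M) (q := 6) (ν₁ := 7) (j' := 1) (by norm_num) hcf hR hn (by omega) hc hc6 hcj' (by norm_num [cnull])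
    simpa using this
  have hΦ : phiK (p + 1) 6 / 2 ≤ (2 : ℚ) ^ (p + 6) / (((p + 7).choose 6 : ℕ) : ℚ) := by
    have := phiK_succ_div_two_le p 6
    rwa [show p + 1 + 6 = p + 7 by omega] at this
  exact c025_core_six_heavy_cell_sq27di2u M p 9 7 16 14 0 68214 1000 15 693 89 14 2112 4392
      ((p + 7).choose 6) (Nat.choose_pos (by omega)) (phiK (p + 1) 6 / 2) hΦ (by norm_num) (by omega)
      (by norm_num) hUG hUH (Or.inl (by norm_num)) (by norm_num) (by norm_num) (by norm_num)
      (s3_cf_of M hfree hcf (d := 8) (by simpa using hd) 32 14 (by norm_num) (by omega) (by norm_num [TriangleCap.cq3]) (by norm_num [TriangleCap.cq3]) (by norm_num [TriangleCap.cq3]))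
      ((S1.ncard_fourCircuits_le_gb14 9 M hfree hd 32 (by rw [coloops_eq_empty_of_forall M hcf, Set.sdiff_empty, hn]; omega)).trans (by decide))
      (s5_cf_of M hfree hcf (d := 8) (by rw [hd]; norm_num) 32 585 693 (by norm_num) (by omega) (by decide) (by omega))
      (s6_cf_of M hfree hcf (d := 8) (by rw [hd]; norm_num) 32 1716 2112 (by norm_num) (by omega) (by decide) (by omega))
      (s7_cf_of M hfree hcf (d := 8) (by rw [hd]; norm_num) 32 3432 4392 (by norm_num) (by omega) (by decide) (by omega))
      (Or.inl (tail_six_heavy_sq23DF9_9 p hp)) hR hn hfree (level_six_poly_heavy_sq23DF9_9 p hp)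

end ThmN

end PercRepro
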